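import Summits.HodgeConjecture.HodgeConjecture.Theorems.NikulinTwinTransportTwinSimilitudeAlgebraicMarkings
import Literature.AlgebraicGeometry.Surfaces.K3Marking

/-!
# Route NikulinTwinTransport · `TwinSimilitudeAlgebraic` (stmt-HodgeConjecture-13674) —
# the Buskin transfer: X = Sim₂(K3) ⟺ ONE algebraic twin similitude, modulo Buskin's theorem

The route files its target X = Sim₂(K3) (`TwinSimilitudeAlgebraic`: every rational,
type-preserving `2`-similitude `ψ : H²(S′(ℂ); ℂ) → H²(S(ℂ); ℂ)` between projective K3 surfaces is
`[γ]_*` for an algebraic class `γ` of codimension `2` on `S × S′`) with the remark "Equivalent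
(Buskin + composition of correspondences) to 'graph(Ψ) is algebraic on every twin pair of the one
completed Nikulin 2-similitude Ψ'". This file PROVES that equivalence in the tree's vocabulary,
modulo exactly: the route item `HodgeIsometryAlgebraic` (Buskin 2019, Thm. 1.1 — the tree's named
fact `Buskin2019_hodgeIsometry_algebraic` verbatim), the named facts
`Huybrechts_K3_periodSurjective_projective`, `Huybrechts_K3_marking_exists`,
`Huybrechts_K3_hodgeTypes_H2` (Huybrechts, *Lectures on K3 Surfaces*), and the composition rule for
algebraic correspondences between K3 surfaces (`hcomp`, symbol for symbol the hypothesis of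
`Buskin2019_hodgeIsometry_algebraic_of_reflective` in `K3SurfaceProofs`; Buskin Lemma 6.3, Fulton
Prop. 16.1.1):

* `twinSimilitudeAlgebraic_of_twinTransport` (⇐): if for ONE `ℂ`-linear `2`-similitude `M` of
  `(Λ_ℂ, k3Form)` with a right inverse `N` defined over `ℚ` (e.g. the integral `2`-similitude
  `U(2) ⊂ U`, `(a, b) ↦ (a + b, a − b)` on `E₈(−1)^{⊕2}` of `Λ_{K3}`, file
  `NikulinTwinTransportTwinSimilitudeAlgebraicLattice`) the TWIN
  SIMILITUDE `η⁻¹ ∘ M ∘ η'` is induced by an algebraic class for every pair of marked projective K3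
  surfaces whose periods correspond under `M` — the deliverable of the route's transport crux — then
  X holds. Proof (Varesco 2023, proof of Thm. 2.1, "similarity = algebraic similarity ∘ isometry",
  with the twin in place of the Nikulin quotient): mark `S, S′`; `σ = η ∘ ψ ∘ η′⁻¹` multiplies the
  K3 form by `+2` (a `−2` would make `N ∘ σ` a rational anti-isometry of `Λ_ℚ`, which does not
  exist); the twin period `N x` of `(S, η)` is a projective period point, realised by a marked
  projective `(S″, η″)` (surjectivity of the period map); `Ψ = η⁻¹ M η″` is algebraic by the twin
  transport, `φ = η″⁻¹ (N σ) η′ = Ψ⁻¹ ∘ ψ` is a rational Hodge isometry (it carries periods to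
  periods because `ψ` preserves the type `(2,0)`), algebraic by Buskin, and `ψ = Ψ ∘ φ` is
  algebraic by composition.
* `twinTransport_of_twinSimilitudeAlgebraic` (⇒): conversely X gives the twin transport for EVERY
  rational `2`-similitude `M` of the K3 lattice and every `M`-twin pair (granted only
  `Huybrechts_K3_hodgeTypes_H2`): the twin similitude is rational, type-preserving and a
  `2`-similitude for the generators of the markings.

So, modulo Buskin's theorem and three textbook facts on K3 surfaces plus the composition of
correspondences, the open target is exactly the algebraicity of one twin similitude on its twin
pairs. Sources: Buskin, J. reine angew. Math. 755 (2019), Thm. 1.1 and §6.2 (Lemma 6.3);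
Varesco, Math. Z. 305 (2023), §2 (proof of Thm. 2.1); Huybrechts, *Lectures on K3 Surfaces*
(2016), Ch. 1 Prop. 3.5, Ch. 6 Prop. 1.2 and Rem. 3.3.
-/

noncomputable section

open CategoryTheory MonoidalCategory
open Literature.AlgebraicGeometry.Motives Literature.AlgebraicGeometry.HodgeTheory
open Literature.AlgebraicGeometry.Surfaces
open Literature.AlgebraicTopology.SingularHomology

namespace Summit.HodgeConjecture.HodgeConjecture.Theorems.NikulinTwinTransport

/-! ### Local notations (the shapes of `K3SurfaceProofs`, verbatim) -/

/-- `MarkedK3[S, η, p, x]`: a MARKED K3 SURFACE WITH PERIOD `x`, in the exact shape of the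
conclusion of `Huybrechts_K3_periodSurjective_projective` / of `Huybrechts_K3_marking_exists`
(`η : H²(S(ℂ); ℂ) ≅ Λ_ℂ` identifies the integral classes with `Λ = ℤ²²` and the cup product with
the lattice form times the integral generator `p` of `H⁴`; `η⁻¹ x` is of type `(2,0)` and spans
the `(2,0)`-classes). Local notation only, copied from `K3SurfaceProofs`. -/
local notation3 (prettyPrint := false) "MarkedK3[" S ", " η ", " p ", " x "]" =>
  (IsIntegralClass p ∧
    (∀ q : complexBetti S (2 * 2), IsIntegralClass q → ∃ n : ℤ, q = n • p) ∧
    (∀ c : complexBetti S (2 * 1), IsIntegralClass c ↔ ∃ v : K3Index → ℤ, η c = fun i => (v i : ℂ)) ∧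
    (∀ a b : complexBetti S (2 * 1),
        cupProduct (rfl : 2 * 1 + 2 * 1 = 2 * 2) a b = k3Form (η a) (η b) • p) ∧
    IsOfHodgeType 2 S (2 * 1) 2 0 (LinearEquiv.symm η x) ∧
    (∀ τ : complexBetti S (2 * 1), IsOfHodgeType 2 S (2 * 1) 2 0 τ → ∃ t : ℂ, τ = t • LinearEquiv.symm η x))

/-- `PeriodPt[x]`: `x ∈ Λ_ℂ` satisfies the hypotheses of `Huybrechts_K3_periodSurjective_projective`
(`(x.x) = 0`, `(x̄.x) > 0`, a positive lattice vector in `x^⊥`). Local notation only, copied from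
`K3SurfaceProofs`. -/
local notation3 (prettyPrint := false) "PeriodPt[" x "]" =>
  (k3Form x x = 0 ∧ 0 < (k3Form (star x) x).re ∧
    ∃ u : K3Index → ℤ, k3Form (fun i => (u i : ℂ)) x = 0 ∧ 0 < ∑ i, ∑ j, u i * k3Gram i j * u j)

/-- `Corr[μ, S, S', hS, hS' ; γ, y] = [γ]_* y = fst_* (snd^* y ∪ γ) ∈ H²(S(ℂ); ℂ)`: the action on
`y ∈ H²(S'(ℂ); ℂ)` of `γ ∈ H⁴((S × S')(ℂ); ℂ)` as a correspondence from `S'` to `S` — literally the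
expression in the conclusions of `Buskin2019_hodgeIsometry_algebraic` and of the route items
`HodgeIsometryAlgebraic`, `TwinSimilitudeAlgebraic` (up to the proof terms of smoothness, which are
propositions). Local notation only, copied from `K3SurfaceProofs`. -/
local notation3 (prettyPrint := false) "Corr[" μ ", " S ", " S' ", " hS ", " hS' " ; " γ ", " y "]" =>
  complexGysin μ
    (IsSmoothProjective.tensor_holds (IsK3Surface.isSmoothProjective hS)
      (IsK3Surface.isSmoothProjective hS'))
    (IsK3Surface.isSmoothProjective hS) (SemiCartesianMonoidalCategory.fst S S')
    (rfl : 2 * 1 + 2 * 2 + 2 * 2 = 2 * 1 + 2 * (2 + 2))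
    (cupProduct (rfl : 2 * 1 + 2 * 2 = 2 * 1 + 2 * 2)
      (complexBetti.map (SemiCartesianMonoidalCategory.snd S S') (2 * 1) y) γ)

/-! ### The transfer theorem: X = Sim₂(K3) from Buskin's theorem and ONE algebraic twin similitude -/

/-- **`TwinSimilitudeAlgebraic` from its ingredients (the route's "Equivalent (Buskin +
composition of correspondences) to 'graph(Ψ) is algebraic on every twin pair of the one completed
2-similitude Ψ'", direction ⇐).** Granted
* `hB` — the route item `HodgeIsometryAlgebraic` (Buskin 2019, Thm. 1.1, = the tree's named fact
  `Buskin2019_hodgeIsometry_algebraic` verbatim): rational Hodge isometries of `H²` of projective K3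
  surfaces are algebraic;
* `hP` — surjectivity of the period map, projective form (named fact
  `Huybrechts_K3_periodSurjective_projective`);
* `hM` — markings with projective periods exist (named fact `Huybrechts_K3_marking_exists`);
* `hHT` — the Hodge types of `H²(K3)` through the `(2,0)`-line (named fact
  `Huybrechts_K3_hodgeTypes_H2`);
* `hcomp` — composition of algebraic correspondences between K3 surfaces is induced by an
  algebraic class (Buskin Lemma 6.3 / Fulton Prop. 16.1.1; symbol for symbol the hypothesis `hcomp`
  of `Buskin2019_hodgeIsometry_algebraic_of_reflective`);
* `htw` — THE TWIN TRANSPORT for ONE `ℂ`-linear `2`-similitude `M` of `(Λ_ℂ, k3Form)` (`hM2`)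
  having a right inverse `N` defined over `ℚ` (`hMN`, `hNrat`; e.g. the integral `2`-similitude
  `U(2) ⊂ U`, `(a, b) ↦ (a + b, a − b)` on `E₈(−1)^{⊕2}` of `Λ_{K3}`,
  `exists_twoSimilitude_k3Lattice` in `NikulinTwinTransportTwinSimilitudeAlgebraicLattice`): for
  every pair of marked projective K3 surfaces `(S, η, p, x)`, `(S', η', p', x')` whose periods
  correspond under `M` (`M x' ∈ ℂ x`), the twin similitude `η⁻¹ ∘ M ∘ η' : H²(S'(ℂ)) → H²(S(ℂ))`
  is `[γ]_*` for an algebraic class `γ` on `S × S'` (the output the route's transport crux is to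
  deliver),
every rational, type-preserving `2`-similitude `ψ : H²(S'(ℂ); ℂ) → H²(S(ℂ); ℂ)` between projective
K3 surfaces is algebraic. PROOF. Mark `S, S'` (`hM`); the generators `p, p'` of the statement agree
with those of the markings up to signs, and `σ = η ∘ ψ ∘ η'⁻¹` multiplies the K3 form by `±2`
(`k3Form_markingConj_signed_mul`); the sign is `+`, for otherwise `N ∘ σ` would be a rational
anti-isometry of `Λ_ℚ` (`not_antiIsometry_k3Form`). The twin period `N x` of the period `x` of
`(S, η)` is a projective period point (`periodPt_twin`), realised by a marked projective K3
surface `(S'', η'')` (`hP`); the twin similitude `Ψ = η⁻¹ ∘ M ∘ η'' : H²(S'') → H²(S)` is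
algebraic (`htw`, period condition `M N x = x`), and `φ = η''⁻¹ ∘ (N ∘ σ) ∘ η' = Ψ⁻¹ ∘ ψ :
H²(S') → H²(S'')` is a rational isometry (`N ∘ σ` is), preserving all Hodge types
(`isOfHodgeType_markingConj`: it carries the period of `S'` to that of `S''` because `ψ` preserves
the type `(2,0)`), hence algebraic by `hB`; finally `ψ = Ψ ∘ φ` is algebraic by `hcomp`.
[cite: Buskin2019, Thm. 1.1, §6.2 Lemma 6.3] [cite: Varesco2023, §2 (proof of Thm. 2.1: similarity = algebraic similarity ∘ isometry)]
[cite: Huybrechts2016K3, Ch. 1 Prop. 3.5, Ch. 6 Prop. 1.2 and Rem. 3.3] -/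
theorem twinSimilitudeAlgebraic_of_twinTransport
    (hB : Theses.NikulinTwinTransport.HodgeIsometryAlgebraic)
    (hP : Huybrechts_K3_periodSurjective_projective)
    (hM : Huybrechts_K3_marking_exists)
    (hHT : Huybrechts_K3_hodgeTypes_H2)
    (hcomp : ∀ (μ : OrientationFamily), μ.HasPoincareDuality →
      ∀ (S S' S'' : SchemeOver ℂ) (hS : IsK3Surface S) (hS' : IsK3Surface S')
      (hS'' : IsK3Surface S''),
      ∀ γ ∈ algebraicClasses (MonoidalCategoryStruct.tensorObj S S') 2,
      ∀ γ' ∈ algebraicClasses (MonoidalCategoryStruct.tensorObj S' S'') 2,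
      ∃ γ'' ∈ algebraicClasses (MonoidalCategoryStruct.tensorObj S S'') 2,
        ∀ y : complexBetti S'' (2 * 1),
          Corr[μ, S, S'', hS, hS'' ; γ'', y] = Corr[μ, S, S', hS, hS' ; γ, Corr[μ, S', S'', hS', hS'' ; γ', y]])
    (M N : Module.End ℂ (K3Index → ℂ))
    (hNrat : ∀ v : K3Index → ℤ, ∃ w : K3Index → ℚ, N (fun i => (v i : ℂ)) = fun i => (w i : ℂ))
    (hMN : M * N = 1) (hM2 : ∀ a b, k3Form (M a) (M b) = 2 * k3Form a b)
    (htw : ∀ (μ : OrientationFamily), μ.HasPoincareDuality →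
      ∀ (S S' : SchemeOver ℂ) (hS : IsK3Surface S) (hS' : IsK3Surface S')
        (η : complexBetti S (2 * 1) ≃ₗ[ℂ] (K3Index → ℂ)) (p : complexBetti S (2 * 2))
        (x : K3Index → ℂ)
        (η' : complexBetti S' (2 * 1) ≃ₗ[ℂ] (K3Index → ℂ)) (p' : complexBetti S' (2 * 2))
        (x' : K3Index → ℂ),
        MarkedK3[S, η, p, x] → PeriodPt[x] → MarkedK3[S', η', p', x'] → PeriodPt[x'] →
        (∃ t : ℂ, M x' = t • x) →
        ∃ γ ∈ algebraicClasses (MonoidalCategoryStruct.tensorObj S S') 2,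
          ∀ y : complexBetti S' (2 * 1), η.symm (M (η' y)) = Corr[μ, S, S', hS, hS' ; γ, y]) :
    Theses.NikulinTwinTransport.TwinSimilitudeAlgebraic := by
  intro μ hμ S S' hS hS' p p' hp hp' ψ hrat htype hsim
  have hSK : IsK3Surface S := hS
  have hSK' : IsK3Surface S' := hS'
  -- `N = M⁻¹` is a `½`-similitude
  have hN2 : ∀ a b, k3Form (N a) (N b) = (2 : ℂ)⁻¹ * k3Form a b := fun a b => by
    have h := hM2 (N a) (N b)
    rw [← Module.End.mul_apply (f := M), ← Module.End.mul_apply (f := M), hMN,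
      Module.End.one_apply, Module.End.one_apply] at h
    rw [h]
    ring
  -- markings of the given surfaces
  obtain ⟨η, p₀, x, hp₀, hm, hx⟩ := hM S hSK
  obtain ⟨η', p₀', x', hp₀', hm', hx'⟩ := hM S' hSK'
  -- the generators of `H⁴` of the statement are those of the markings up to sign
  have hsg : p = p₀ ∨ p = -p₀ := eq_or_eq_neg_of_zsmul hp₀ (hp.2 p₀ hm.1) (hm.2.1 p hp.1)
  have hsg' : p' = p₀' ∨ p' = -p₀' :=
    eq_or_eq_neg_of_zsmul hp₀' (hp'.2 p₀' hm'.1) (hm'.2.1 p' hp'.1)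
  obtain ⟨s, hs, hs1⟩ : ∃ s : ℂ, p = s • p₀ ∧ (s = 1 ∨ s = -1) := by
    rcases hsg with hsg | hsg
    · exact ⟨1, by rw [hsg, one_smul], Or.inl rfl⟩
    · exact ⟨-1, by rw [hsg, neg_one_smul], Or.inr rfl⟩
  obtain ⟨s', hs', hs1'⟩ : ∃ s' : ℂ, p₀' = s' • p' ∧ (s' = 1 ∨ s' = -1) := by
    rcases hsg' with hsg' | hsg'
    · exact ⟨1, by rw [hsg', one_smul], Or.inl rfl⟩
    · exact ⟨-1, by rw [hsg', smul_neg, neg_one_smul, neg_neg], Or.inr rfl⟩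
  have hp'eq : p' = s' • p₀' := by
    rcases hs1' with rfl | rfl
    · rw [one_smul] at hs'
      rw [one_smul, hs']
    · rw [hs', smul_smul]
      norm_num
  -- `σ = η ∘ ψ ∘ η'⁻¹` multiplies the K3 form by `s' s 2` and is defined over `ℚ`
  set σ : Module.End ℂ (K3Index → ℂ) := η.toLinearMap ∘ₗ ψ ∘ₗ η'.symm.toLinearMap with hσdef
  have hσrat : ∀ v : K3Index → ℤ, ∃ w : K3Index → ℚ, σ (fun i => (v i : ℂ)) = fun i => (w i : ℂ) :=
    markingConj_intCast hSK η hm.2.2.1 η' hm'.2.2.1 ψ hrat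
  have hσform : ∀ a b, k3Form (σ a) (σ b) = s' * s * 2 * k3Form a b :=
    k3Form_markingConj_signed_mul η p₀ p hp₀ s hs hm.2.2.2.1 η' p₀' p' s' hs' hm'.2.2.2.1 2 ψ hsim
  -- `ρ = N ∘ σ` multiplies the form by `s' s = ±1`; an anti-isometry of `Λ_ℚ` does not exist
  have hρrat : ∀ v : K3Index → ℤ, ∃ w : K3Index → ℚ, (N * σ) (fun i => (v i : ℂ)) = fun i => (w i : ℂ) :=
    ratEnd_mul N σ hNrat hσrat
  have hρform : ∀ a b, k3Form ((N * σ) a) ((N * σ) b) = s' * s * k3Form a b := fun a b => by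
    rw [Module.End.mul_apply, Module.End.mul_apply, hN2, hσform]
    ring
  have hss : s' * s = 1 := by
    rcases hs1 with rfl | rfl <;> rcases hs1' with rfl | rfl
    · norm_num
    · exact (not_antiIsometry_k3Form (N * σ) (fun a b => by rw [hρform]; ring) hρrat).elim
    · exact (not_antiIsometry_k3Form (N * σ) (fun a b => by rw [hρform]; ring) hρrat).elim
    · norm_num
  have hρiso : ∀ a b, k3Form ((N * σ) a) ((N * σ) b) = 1 * k3Form a b := fun a b => by
    rw [hρform, hss]
  -- the twin period `N x` and the twin surface `S''`
  have hx'' : PeriodPt[N x] := periodPt_twin N hNrat hN2 hx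
  obtain ⟨S'', hSK'', η'', p'', hm''⟩ := hP (N x) hx''.1 hx''.2.1 hx''.2.2
  -- period conditions: `M (N x) = x`, and `(N ∘ σ) x' ∈ ℂ · N x` because `ψ` preserves `(2,0)`
  have hper1 : ∃ t : ℂ, M (N x) = t • x :=
    ⟨1, by rw [← Module.End.mul_apply (f := M), hMN, Module.End.one_apply, one_smul]⟩
  have hper2 : ∃ t : ℂ, (N * σ) x' = t • N x := by
    have h20 : IsOfHodgeType 2 S (2 * 1) 2 0 (ψ (η'.symm x')) := htype 2 0 _ hm'.2.2.2.2.1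
    obtain ⟨t, ht⟩ := hm.2.2.2.2.2 _ h20
    refine ⟨t, ?_⟩
    rw [Module.End.mul_apply, hσdef]
    simp only [LinearMap.coe_comp, LinearEquiv.coe_coe, Function.comp_apply]
    rw [ht, map_smul, LinearEquiv.apply_symm_apply, map_smul]
  -- (A) the twin similitude `Ψ = η⁻¹ ∘ M ∘ η'' : H²(S'') → H²(S)` is algebraic
  obtain ⟨γ₁, hγ₁, hγ₁eq⟩ := htw μ hμ S S'' hSK hSK'' η p₀ x η'' p'' (N x) hm hx hm'' hx'' hper1
  -- (B) `φ = η''⁻¹ ∘ (N ∘ σ) ∘ η' : H²(S') → H²(S'')` is a rational Hodge isometry, algebraic by Buskin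
  set φ : complexBetti S' (2 * 1) →ₗ[ℂ] complexBetti S'' (2 * 1) :=
    η''.symm.toLinearMap ∘ₗ (N * σ) ∘ₗ η'.toLinearMap with hφdef
  have hφapp : ∀ y, φ y = η''.symm ((N * σ) (η' y)) := fun y => rfl
  have hφrat : ∀ y, IsRationalClass y → IsRationalClass (φ y) := fun y hy => by
    rw [hφapp]
    exact isRationalClass_markingConj η'' η' (N * σ) hSK'' hSK' hm''.2.2.1 hm'.2.2.1 hρrat hy
  have hφtype : ∀ (i j : ℕ) (y : complexBetti S' (2 * 1)),
      IsOfHodgeType 2 S' (2 * 1) i j y → IsOfHodgeType 2 S'' (2 * 1) i j (φ y) := fun i j y hy => by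
    rw [hφapp]
    exact isOfHodgeType_markingConj η'' p'' (N x) η' p₀' x' (N * σ) hHT hSK'' hSK' hm''.2.2.1
      hm''.2.2.2.1 hm''.2.2.2.2.1 hx''.2.1 hm'.2.2.1 hm'.2.2.2.1 hp₀' hm'.2.2.2.2.1 hx'.2.1 hρrat
      one_ne_zero hρiso hper2 i j y hy
  -- the generator `s' • p''` of `H⁴(S'')` matching the sign of `p'`
  have hq''int : IsIntegralClass (s' • p'') := by
    rcases hs1' with rfl | rfl
    · rw [one_smul]
      exact hm''.1
    · have h := hm''.1.zsmul (-1)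
      rwa [Int.cast_neg, Int.cast_one] at h
  have hq''gen : ∀ q : complexBetti S'' (2 * 2), IsIntegralClass q → ∃ n : ℤ, q = n • (s' • p'') :=
    fun q hq => by
    obtain ⟨n, hn⟩ := hm''.2.1 q hq
    rcases hs1' with rfl | rfl
    · exact ⟨n, by rw [one_smul]; exact hn⟩
    · exact ⟨-n, by rw [hn, neg_one_smul, neg_smul, smul_neg, neg_neg]⟩
  have hφiso : ∀ (y z : complexBetti S' (2 * 1)) (a : ℂ),
      cupProduct (rfl : 2 * 1 + 2 * 1 = 2 * 2) y z = a • p' →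
        cupProduct (rfl : 2 * 1 + 2 * 1 = 2 * 2) (φ y) (φ z) = a • (s' • p'') := fun y z a h => by
    rw [hφapp, hφapp]
    rw [hp'eq, smul_smul] at h
    rw [cupProduct_markingConj η'' p'' η' p₀' (N * σ) hp₀' hm''.2.2.2.1 hm'.2.2.2.1 hρiso y z
      (a * s') h, smul_smul]
    congr 1
    ring
  obtain ⟨γ₂, hγ₂, hγ₂eq⟩ :=
    hB μ hμ S'' S' hSK'' hSK' (s' • p'') p' ⟨hq''int, hq''gen⟩ hp' φ hφrat hφtype hφiso
  -- (C) compose: `ψ = Ψ ∘ φ`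
  obtain ⟨γ, hγ, hγeq⟩ := hcomp μ hμ S S'' S' hSK hSK'' hSK' γ₁ hγ₁ γ₂ hγ₂
  refine ⟨γ, hγ, fun y => ?_⟩
  have hψ : ψ y = η.symm (M (η'' (φ y))) := by
    rw [hφapp, LinearEquiv.apply_symm_apply, Module.End.mul_apply, ← Module.End.mul_apply (f := M),
      hMN, Module.End.one_apply, hσdef]
    simp only [LinearMap.coe_comp, LinearEquiv.coe_coe, Function.comp_apply,
      LinearEquiv.symm_apply_apply]
  rw [hψ, hγ₁eq, hγ₂eq y]
  exact (hγeq y).symm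

/-- **The converse transfer (direction ⇒ of the route's "Equivalent …"): `TwinSimilitudeAlgebraic`
gives the twin transport.** Granted the Hodge types of `H²(K3)` (`hHT`), if every rational,
type-preserving `2`-similitude between projective K3 surfaces is algebraic, then for EVERY
`ℂ`-linear `2`-similitude `M` of `(Λ_ℂ, k3Form)` defined over `ℚ` and every pair of marked
projective K3 surfaces whose periods correspond under `M`, the twin similitude `η⁻¹ ∘ M ∘ η'` is
`[γ]_*` for an algebraic `γ` — it is rational (`isRationalClass_markingConj`), type-preserving
(`isOfHodgeType_markingConj`) and a `2`-similitude for the generators of the markings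
(`cupProduct_markingConj`; these are non-zero, `generator_ne_zero`). So, modulo Buskin's theorem,
the three K3 facts and the composition of correspondences, the target X = Sim₂(K3) is EQUIVALENT
to the twin transport for any single rational `2`-similitude of the K3 lattice.
[cite: Buskin2019, §6.2] [cite: Huybrechts2016K3, Ch. 6 Prop. 1.2 and Rem. 3.3] -/
theorem twinTransport_of_twinSimilitudeAlgebraic (hHT : Huybrechts_K3_hodgeTypes_H2)
    (hX : Theses.NikulinTwinTransport.TwinSimilitudeAlgebraic)
    (M : Module.End ℂ (K3Index → ℂ))
    (hMrat : ∀ v : K3Index → ℤ, ∃ w : K3Index → ℚ, M (fun i => (v i : ℂ)) = fun i => (w i : ℂ))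
    (hM2 : ∀ a b, k3Form (M a) (M b) = 2 * k3Form a b)
    (μ : OrientationFamily) (hμ : μ.HasPoincareDuality)
    (S S' : SchemeOver ℂ) (hS : IsK3Surface S) (hS' : IsK3Surface S')
    (η : complexBetti S (2 * 1) ≃ₗ[ℂ] (K3Index → ℂ)) (p : complexBetti S (2 * 2)) (x : K3Index → ℂ)
    (η' : complexBetti S' (2 * 1) ≃ₗ[ℂ] (K3Index → ℂ)) (p' : complexBetti S' (2 * 2))
    (x' : K3Index → ℂ)
    (hm : MarkedK3[S, η, p, x]) (hx : PeriodPt[x]) (hm' : MarkedK3[S', η', p', x']) (hx' : PeriodPt[x'])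
    (hper : ∃ t : ℂ, M x' = t • x) :
    ∃ γ ∈ algebraicClasses (MonoidalCategoryStruct.tensorObj S S') 2,
      ∀ y : complexBetti S' (2 * 1), η.symm (M (η' y)) = Corr[μ, S, S', hS, hS' ; γ, y] := by
  have hp'0 : p' ≠ 0 := generator_ne_zero hS' hm'.2.1
  obtain ⟨γ, hγ, hγeq⟩ := hX μ hμ S S' hS hS' p p' ⟨hm.1, hm.2.1⟩ ⟨hm'.1, hm'.2.1⟩
    (η.symm.toLinearMap ∘ₗ M ∘ₗ η'.toLinearMap)
    (fun y hy => isRationalClass_markingConj η η' M hS hS' hm.2.2.1 hm'.2.2.1 hMrat hy)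
    (fun i j y hy => isOfHodgeType_markingConj η p x η' p' x' M hHT hS hS' hm.2.2.1 hm.2.2.2.1
      hm.2.2.2.2.1 hx.2.1 hm'.2.2.1 hm'.2.2.2.1 hp'0 hm'.2.2.2.2.1 hx'.2.1 hMrat two_ne_zero hM2
      hper i j y hy)
    (fun y z a h => cupProduct_markingConj η p η' p' M hp'0 hm.2.2.2.1 hm'.2.2.2.1 hM2 y z a h)
  exact ⟨γ, hγ, fun y => hγeq y⟩

end Summit.HodgeConjecture.HodgeConjecture.Theorems.NikulinTwinTransport

end
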